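import Literature.Computability.MetaComplexity.EFOpKit
import HarnessLib

/-!
# Chains over an operation kit: the template

Layer E/2 of the `EF`-proof construction kit. For an operation kit `k` (`EFOpKit.lean`) the
**chain template** `k.chainT` computes the double-and-add fold of `∘` along the bits of `b`:

  `s₀ = a`, `s_{j+1} = s_j ∘ s_j`;  `t₀ = e`, `t_{j+1} = b_j ? (t_j ∘ s_j) : t_j`  (`j < W`),

with result `t_W`, followed by a comparator of `t_W` with `n` (so that `k.chainT` is again in the
input/result/comparator convention of kits). Over modular addition this is multiplication
`a · b mod n`, over multiplication it is exponentiation `a ^ b mod n`. This file defines the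
template by pieces (`Netlist.layout`), computes its offsets, proves it well formed, and provides
the views of an available occurrence: the sub-occurrences `S_j = s_j ∘ s_j`, `P_j = t_j ∘ s_j`,
the constant, multiplexer and comparator definitions.

## Sources

* H. Vollmer, *Introduction to Circuit Complexity* (Springer 1999), §1.2 (composition of circuits).
* J. Krajíček, *Bounded Arithmetic, Propositional Logic, and Complexity Theory* (CUP 1995), §9.2.
-/

namespace Literature.Computability.MetaComplexity

open _root_.Computability Complexity Complexity.PropForm FregeSystem Netlist

namespace Netlist

/-- Availability of an occurrence only depends on its base and its inputs below `nIn`.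
[folklore] -/
theorem Occ.Avail.congr {o o' : Occ} {t : Template} {nIn : ℕ} {K : PropForm ℕ} {Γ : Set (PropForm ℕ)} (h : o.Avail t nIn K Γ)
    (hb : o'.base = o.base) (hi : ∀ i < nIn, o'.inp i = o.inp i) : o'.Avail t nIn K Γ := by
  have e : o'.inst nIn = o.inst nIn := by
    simp only [Occ.inst, hb]
    congr 1
    exact List.map_congr_left fun i hi' => hi i (List.mem_range.1 hi')
  unfold Occ.Avail; rw [e]; exact h

/-- A row of `W` constant gates with the bit pattern `e`. [folklore] -/
def constRow (e : ℕ → Bool) (W : ℕ) : Template := (List.range W).map fun i => ⟨Kind.cst (e i), []⟩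

/-- Length of a constant row. [folklore] -/
@[simp] theorem length_constRow (e : ℕ → Bool) (W : ℕ) : (constRow e W).length = W := by simp [constRow]

/-- Gates of a constant row. [folklore] -/
theorem getElem_constRow (e : ℕ → Bool) (W : ℕ) {i : ℕ} (h : i < (constRow e W).length) : (constRow e W)[i] = ⟨Kind.cst (e i), []⟩ := by
  simp [constRow]

/-- A constant row is well formed (any number of inputs). [cite: Vollmer1999, Def. 1.6] -/
theorem wf_constRow (e : ℕ → Bool) (W nIn : ℕ) : (constRow e W).WF nIn := by
  intro k hk
  rw [getElem_constRow]
  exact ⟨rfl, fun a ha => by simp at ha⟩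

end Netlist

namespace ModAdd

namespace OpKit

variable {W : ℕ} (k : OpKit W)

/-! ### The pieces of the chain -/

/-- The block size: two occurrences of the operation and a multiplexer row. [folklore] -/
def B : ℕ := 2 * k.T.length + W

/-- Offset of `S_j` (the constants occupy `0 … W-1`). [folklore] -/
def offS (j : ℕ) : ℕ := W + j * k.B

/-- Source of the bit `i` of `s_j`: the input `a_i` for `j = 0`, a result wire of `S_{j-1}` else.
[folklore] -/
def sSrc : ℕ → ℕ → ℕ ⊕ ℕ
  | 0, i => Sum.inl i
  | j + 1, i => Sum.inr (k.offS j + k.resOff i)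

/-- Source of the bit `i` of `t_j`: the constant gate `i` for `j = 0`, a multiplexer of block
`j-1` else. [folklore] -/
def tSrc : ℕ → ℕ → ℕ ⊕ ℕ
  | 0, i => Sum.inr i
  | j + 1, i => Sum.inr (k.offS j + 2 * k.T.length + i)

/-- Wiring of `S_j = s_j ∘ s_j`. [folklore] -/
def wS (j q : ℕ) : ℕ ⊕ ℕ := if q < W then k.sSrc j q else if q < 2 * W then k.sSrc j (q - W) else Sum.inl q

/-- Wiring of `P_j = t_j ∘ s_j`. [folklore] -/
def wP (j q : ℕ) : ℕ ⊕ ℕ := if q < W then k.tSrc j q else if q < 2 * W then k.sSrc j (q - W) else Sum.inl q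

/-- Wiring of the multiplexer row `t_{j+1} = b_j ? res(P_j) : t_j`. [folklore] -/
def wM (j q : ℕ) : ℕ ⊕ ℕ :=
  if q = 0 then Sum.inl (W + j) else if q < W + 1 then Sum.inr (k.offS j + k.T.length + k.resOff (q - 1)) else k.tSrc j (q - (W + 1))

/-- Wiring of the final comparator of `t_W` with `n`. [folklore] -/
def wC (q : ℕ) : ℕ ⊕ ℕ := if q < W then k.tSrc W q else Sum.inl (W + q)

/-- The piece of block `j`, part `r` (`0 = S_j`, `1 = P_j`, `2 =` multiplexers). [folklore] -/
def chPiece (j r : ℕ) : Piece :=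
  if r = 0 then ⟨k.T, 3 * W, k.wS j⟩ else if r = 1 then ⟨k.T, 3 * W, k.wP j⟩ else ⟨muxRow W, 2 * W + 1, k.wM j⟩

/-- The pieces: constants, `W` blocks, comparator. [cite: Vollmer1999, §1.2] -/
def pieces : ℕ → Piece
  | 0 => ⟨constRow k.e W, 0, fun _ => Sum.inl 0⟩
  | q + 1 => if q < 3 * W then k.chPiece (q / 3) (q % 3) else ⟨Sub.subT W, 2 * W, k.wC⟩

/-- **The chain template.** [cite: Vollmer1999, §1.2] [cite: Krajicek1995, §9.2] -/
def chainT : Template := layout k.pieces (3 * W + 2)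

/-! ### Offsets -/

/-- The pieces of block `j < W`. [folklore] -/
theorem pieces_blk {j : ℕ} (hj : j < W) (r : ℕ) (hr : r < 3) : k.pieces (3 * j + r + 1) = k.chPiece j r := by
  show (if 3 * j + r < 3 * W then k.chPiece ((3 * j + r) / 3) ((3 * j + r) % 3) else _) = _
  rw [if_pos (by omega), show (3 * j + r) / 3 = j by omega, show (3 * j + r) % 3 = r by omega]

/-- The last piece is the comparator. [folklore] -/
theorem pieces_cmp : k.pieces (3 * W + 1) = ⟨Sub.subT W, 2 * W, k.wC⟩ := by
  show (if 3 * W < 3 * W then _ else _) = _; rw [if_neg (lt_irrefl _)]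

/-- Lengths of the block pieces. [folklore] -/
theorem length_chPiece (j r : ℕ) : (k.chPiece j r).T.length = if r < 2 then k.T.length else W := by
  unfold chPiece; split_ifs <;> first | rfl | (exact length_muxRow W) | omega

/-- **Offsets of the blocks**: `S_j` sits at `offS j`. [folklore] -/
theorem offset_S : ∀ {j : ℕ}, j ≤ W → offset k.pieces (3 * j + 1) = k.offS j
  | 0, _ => by rw [show 3 * 0 + 1 = 0 + 1 from rfl, offset_succ, offset_zero]; simp [pieces, offS]
  | j + 1, hj => by
    have hj' : j < W := by omega
    have h1 : offset k.pieces (3 * j + 1 + 1) = k.offS j + k.T.length := by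
      rw [offset_succ, offset_S (by omega), show 3 * j + 1 = 3 * j + 0 + 1 by ring, k.pieces_blk hj' 0 (by norm_num), length_chPiece]; rfl
    have h2 : offset k.pieces (3 * j + 2 + 1) = k.offS j + 2 * k.T.length := by
      rw [offset_succ, show 3 * j + 2 = 3 * j + 1 + 1 by ring, h1, k.pieces_blk hj' 1 (by norm_num), length_chPiece]; simp; ring
    rw [show 3 * (j + 1) + 1 = 3 * j + 3 + 1 by ring, offset_succ, show 3 * j + 3 = 3 * j + 2 + 1 by ring, h2,
      k.pieces_blk hj' 2 (by norm_num), length_chPiece, if_neg (by norm_num)]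
    simp [offS, B]; ring

/-- Offset of `P_j`. [folklore] -/
theorem offset_P {j : ℕ} (hj : j < W) : offset k.pieces (3 * j + 1 + 1) = k.offS j + k.T.length := by
  rw [offset_succ, k.offset_S hj.le, show 3 * j + 1 = 3 * j + 0 + 1 by ring, k.pieces_blk hj 0 (by norm_num), length_chPiece]; rfl

/-- Offset of the multiplexer row of block `j`. [folklore] -/
theorem offset_M {j : ℕ} (hj : j < W) : offset k.pieces (3 * j + 2 + 1) = k.offS j + 2 * k.T.length := by
  rw [offset_succ, show 3 * j + 2 = 3 * j + 1 + 1 by ring, k.offset_P hj, k.pieces_blk hj 1 (by norm_num), length_chPiece]; simp; ring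

/-- Offset of the comparator. [folklore] -/
theorem offset_C : offset k.pieces (3 * W + 1) = k.offS W := k.offset_S le_rfl

/-- The next block starts after the multiplexer row. [folklore] -/
theorem offS_succ (j : ℕ) : k.offS (j + 1) = k.offS j + 2 * k.T.length + W := by simp [offS, B]; ring

/-- **Length of the chain template**: `W + W · (2L + W) + (3W + 1)`. [folklore] -/
theorem length_chainT : k.chainT.length = k.offS W + (3 * W + 1) := by
  rw [chainT, length_layout, show 3 * W + 2 = 3 * W + 1 + 1 by ring, offset_succ, k.offset_C, k.pieces_cmp]; simp

/-! ### Well-formedness -/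

/-- The sources of `s_j` are inputs or earlier gates. [folklore] -/
theorem sSrc_ok {j i : ℕ} (hi : i < W) :
    (∀ a, k.sSrc j i = Sum.inl a → a < 3 * W) ∧ (∀ g, k.sSrc j i = Sum.inr g → g < k.offS j) := by
  rcases j with _ | j
  · refine ⟨fun a ha => ?_, fun g hg => ?_⟩
    · cases ha; omega
    · cases hg
  · refine ⟨fun a ha => ?_, fun g hg => ?_⟩
    · cases ha
    · cases hg; have := k.resOff_lt i hi; rw [offS_succ]; omega

/-- The sources of `t_j` are earlier gates. [folklore] -/
theorem tSrc_ok {j i : ℕ} (hi : i < W) : (∀ a, k.tSrc j i = Sum.inl a → a < 3 * W) ∧ (∀ g, k.tSrc j i = Sum.inr g → g < k.offS j) := by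
  rcases j with _ | j
  · refine ⟨fun a ha => ?_, fun g hg => ?_⟩
    · cases ha
    · cases hg; simp [offS]; omega
  · refine ⟨fun a ha => ?_, fun g hg => ?_⟩
    · cases ha
    · cases hg; rw [offS_succ]; omega

/-- Every piece is well formed and well wired. [cite: Vollmer1999, Def. 1.6] -/
theorem piece_ok : ∀ q < 3 * W + 2, Piece.OK k.pieces (3 * W) q := by
  intro q hq
  rcases q with _ | q
  · exact ⟨wf_constRow _ _ _, fun i hi => absurd hi (Nat.not_lt_zero i)⟩
  by_cases hqW : q < 3 * W
  · obtain ⟨j, r, hr, rfl⟩ : ∃ j r, r < 3 ∧ q = 3 * j + r := ⟨q / 3, q % 3, Nat.mod_lt _ (by norm_num), by omega⟩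
    have hj : j < W := by omega
    unfold Piece.OK
    rw [k.pieces_blk hj r hr]
    have hoff : k.offS j ≤ offset k.pieces (3 * j + r + 1) := by
      interval_cases r
      · rw [Nat.add_zero, k.offset_S hj.le]
      · rw [k.offset_P hj]; omega
      · rw [k.offset_M hj]; omega
    interval_cases r
    · rw [show k.chPiece j 0 = ⟨k.T, 3 * W, k.wS j⟩ from rfl]
      refine ⟨k.wf, fun i hi => ?_⟩
      show (∀ a, k.wS j i = Sum.inl a → _) ∧ (∀ g, k.wS j i = Sum.inr g → _)
      unfold wS; split_ifs with h1 h2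
      · exact ⟨(k.sSrc_ok h1).1, fun g hg => lt_of_lt_of_le ((k.sSrc_ok h1).2 g hg) hoff⟩
      · exact ⟨(k.sSrc_ok (by omega)).1, fun g hg => lt_of_lt_of_le ((k.sSrc_ok (i := i - W) (by omega)).2 g hg) hoff⟩
      · exact ⟨fun a ha => (by cases ha; have : i < 3 * W := hi; omega), fun g hg => (by cases hg)⟩
    · rw [show k.chPiece j 1 = ⟨k.T, 3 * W, k.wP j⟩ from rfl]
      refine ⟨k.wf, fun i hi => ?_⟩
      show (∀ a, k.wP j i = Sum.inl a → _) ∧ (∀ g, k.wP j i = Sum.inr g → _)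
      unfold wP; split_ifs with h1 h2
      · exact ⟨(k.tSrc_ok h1).1, fun g hg => lt_of_lt_of_le ((k.tSrc_ok h1).2 g hg) hoff⟩
      · exact ⟨(k.sSrc_ok (by omega)).1, fun g hg => lt_of_lt_of_le ((k.sSrc_ok (i := i - W) (by omega)).2 g hg) hoff⟩
      · exact ⟨fun a ha => (by cases ha; have : i < 3 * W := hi; omega), fun g hg => (by cases hg)⟩
    · rw [show k.chPiece j 2 = ⟨muxRow W, 2 * W + 1, k.wM j⟩ from rfl]
      refine ⟨wf_muxRow W, fun i hi => ?_⟩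
      have hi' : i < 2 * W + 1 := hi
      show (∀ a, k.wM j i = Sum.inl a → _) ∧ (∀ g, k.wM j i = Sum.inr g → _)
      unfold wM; split_ifs with h1 h2
      · exact ⟨fun a ha => (by cases ha; omega), fun g hg => (by cases hg)⟩
      · refine ⟨fun a ha => (by cases ha), fun g hg => ?_⟩
        cases hg; have := k.resOff_lt (i - 1) (by omega); rw [k.offset_M hj]; omega
      · exact ⟨(k.tSrc_ok (by omega)).1, fun g hg => lt_of_lt_of_le ((k.tSrc_ok (i := i - (W + 1)) (by omega)).2 g hg) hoff⟩
  · have hq : q = 3 * W := by omega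
    subst hq
    unfold Piece.OK
    rw [k.pieces_cmp]
    refine ⟨Sub.wf_subT W, fun i hi => ?_⟩
    have hi' : i < 2 * W := hi
    show (∀ a, k.wC i = Sum.inl a → _) ∧ (∀ g, k.wC i = Sum.inr g → _)
    unfold wC; split_ifs with h1
    · exact ⟨(k.tSrc_ok h1).1, fun g hg => by rw [k.offset_C]; exact (k.tSrc_ok h1).2 g hg⟩
    · exact ⟨fun a ha => (by cases ha; omega), fun g hg => (by cases hg)⟩

/-- **The chain template is well formed** (`3W` inputs: `a, b, n`). [cite: Vollmer1999, Def. 1.6] -/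
theorem wf_chainT : k.chainT.WF (3 * W) := wf_layout k.pieces k.piece_ok

/-! ### Views of an occurrence of the chain -/

variable (o : Occ)

/-- The word `s_j` of an occurrence. [folklore] -/
def s : ℕ → ℕ → ℕ
  | 0, i => o.inp i
  | j + 1, i => o.base + k.offS j + k.resOff i

/-- The word `t_j` of an occurrence (`t_0` are the constants, `t_{j+1}` the multiplexers of block
`j`). [folklore] -/
def t : ℕ → ℕ → ℕ
  | 0, i => o.base + i
  | j + 1, i => o.base + k.offS j + 2 * k.T.length + i

/-- The sub-occurrence `S_j = s_j ∘ s_j`. [folklore] -/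
def So (j : ℕ) : Occ := ⟨o.base + k.offS j, fun q => if q < W then k.s o j q else if q < 2 * W then k.s o j (q - W) else o.inp q⟩

/-- The sub-occurrence `P_j = t_j ∘ s_j`. [folklore] -/
def Po (j : ℕ) : Occ := ⟨o.base + k.offS j + k.T.length, fun q => if q < W then k.t o j q else if q < 2 * W then k.s o j (q - W) else o.inp q⟩

/-- The result word of `P_j`. [folklore] -/
def p (j : ℕ) : ℕ → ℕ := k.res (k.Po o j)

/-- The final comparator of `t_W` with `n`. [folklore] -/
def cmpC : Sub.View := ⟨o.base + k.offS W, k.t o W, on W o⟩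

/-- `ChainViews k o K Γ`: the constant definitions, the sub-occurrences, the multiplexer relations
and the final comparator of an occurrence of the chain are available. [folklore] -/
structure ChainViews (K : PropForm ℕ) (Γ : Set (PropForm ℕ)) : Prop where
  /-- the constants `t_0 = e` -/
  cst : ∀ i < W, ctx K (biimp (var (k.t o 0 i)) (const (k.e i))) ∈ Γ
  /-- `S_j` -/
  S : ∀ j < W, (k.So o j).Avail k.T (3 * W) K Γ
  /-- `P_j` -/
  P : ∀ j < W, (k.Po o j).Avail k.T (3 * W) K Γ
  /-- the multiplexers `t_{j+1} = b_j ? p_j : t_j` -/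
  mux : ∀ j < W, ∀ i < W, ctx K (muxRel (o.inp (W + j)) (k.t o (j + 1) i) (k.p o j i) (k.t o j i)) ∈ Γ
  /-- the comparator -/
  cmp : (k.cmpC o).Avail K Γ W

variable {k o}

/-- The chain views are monotone. [folklore] -/
theorem ChainViews.mono {K : PropForm ℕ} {Γ Γ' : Set (PropForm ℕ)} (h : k.ChainViews o K Γ) (hΓ : Γ ⊆ Γ') : k.ChainViews o K Γ' :=
  ⟨fun i hi => hΓ (h.cst i hi), fun j hj => (h.S j hj).mono hΓ, fun j hj => (h.P j hj).mono hΓ, fun j hj i hi => hΓ (h.mux j hj i hi), h.cmp.mono hΓ⟩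

/-- The sources evaluate to the words. [folklore] -/
theorem ref_sSrc (j : ℕ) {i : ℕ} (hi : i < W) : (o.inst (3 * W)).ref (k.sSrc j i) = k.s o j i := by
  cases j with
  | zero => exact o.ref_inl (by omega)
  | succ j => show o.wire _ = _; simp [Occ.wire, s, Nat.add_assoc]

/-- The sources evaluate to the words. [folklore] -/
theorem ref_tSrc (j i : ℕ) : (o.inst (3 * W)).ref (k.tSrc j i) = k.t o j i := by
  cases j with
  | zero => rfl
  | succ j => show o.wire _ = _; simp [Occ.wire, t, Nat.add_assoc]

/-- **An available occurrence of the chain provides the chain views.** [folklore] -/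
theorem chainAvail {K : PropForm ℕ} {Γ : Set (PropForm ℕ)} (ho : o.Avail k.chainT (3 * W) K Γ) : k.ChainViews o K Γ := by
  have hI : (o.inst (3 * W)).DefsAvail (layout k.pieces (3 * W + 2)) K Γ := ho
  refine ⟨fun i hi => ?_, fun j hj => ?_, fun j hj => ?_, fun j hj i hi => ?_, ?_⟩
  · -- constants, piece 0
    obtain ⟨hk, heq⟩ := getElem_layout k.pieces (k := 0) (N := 3 * W + 2) (j := i) (by omega) (by simpa [pieces] using hi)
    have h := hI (offset k.pieces 0 + i) hk
    rw [heq, offset_zero] at h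
    have hg : (k.pieces 0).T[i]'(by simpa [pieces] using hi) = ⟨Kind.cst (k.e i), []⟩ := getElem_constRow _ _ _
    rw [hg] at h
    simpa [Inst.body, Kind.body, t, Occ.wire_inst, Occ.wire] using h
  · -- `S_j`, piece `3j+1`
    have h := hI.piece (k := 3 * j + 0 + 1) (by omega) (by rw [k.pieces_blk hj 0 (by norm_num)]; exact k.wf)
    rw [k.pieces_blk hj 0 (by norm_num), show k.chPiece j 0 = ⟨k.T, 3 * W, k.wS j⟩ from rfl] at h
    refine h.congr ?_ fun q hq => ?_
    · show o.base + k.offS j = o.base + offset k.pieces (3 * j + 0 + 1); rw [Nat.add_zero, k.offset_S hj.le]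
    · have hq' : q < 3 * W := hq
      show (if q < W then k.s o j q else if q < 2 * W then k.s o j (q - W) else o.inp q) = (o.inst (3 * W)).ref ((k.pieces (3 * j + 0 + 1)).wire q)
      rw [k.pieces_blk hj 0 (by norm_num)]
      show _ = (o.inst (3 * W)).ref (k.wS j q)
      unfold wS; split_ifs with h1 h2
      · exact (ref_sSrc j h1).symm
      · exact (ref_sSrc j (by omega)).symm
      · exact (o.ref_inl hq').symm
  · -- `P_j`, piece `3j+2`
    have h := hI.piece (k := 3 * j + 1 + 1) (by omega) (by rw [k.pieces_blk hj 1 (by norm_num)]; exact k.wf)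
    rw [k.pieces_blk hj 1 (by norm_num), show k.chPiece j 1 = ⟨k.T, 3 * W, k.wP j⟩ from rfl] at h
    refine h.congr ?_ fun q hq => ?_
    · show o.base + k.offS j + k.T.length = o.base + offset k.pieces (3 * j + 1 + 1); rw [k.offset_P hj, Nat.add_assoc]
    · have hq' : q < 3 * W := hq
      show (if q < W then k.t o j q else if q < 2 * W then k.s o j (q - W) else o.inp q) = (o.inst (3 * W)).ref ((k.pieces (3 * j + 1 + 1)).wire q)
      rw [k.pieces_blk hj 1 (by norm_num)]
      show _ = (o.inst (3 * W)).ref (k.wP j q)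
      unfold wP; split_ifs with h1 h2
      · exact (ref_tSrc j q).symm
      · exact (ref_sSrc j (by omega)).symm
      · exact (o.ref_inl hq').symm
  · -- multiplexers, piece `3j+3`
    have hT : (k.pieces (3 * j + 2 + 1)).T = muxRow W := by rw [k.pieces_blk hj 2 (by norm_num)]; rfl
    have hw : (k.pieces (3 * j + 2 + 1)).wire = k.wM j := by rw [k.pieces_blk hj 2 (by norm_num)]; rfl
    have hlen : i < (k.pieces (3 * j + 2 + 1)).T.length := by rw [hT, length_muxRow]; exact hi
    obtain ⟨hk, heq⟩ := getElem_layout k.pieces (k := 3 * j + 2 + 1) (N := 3 * W + 2) (j := i) (by omega) hlen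
    have h := hI (offset k.pieces (3 * j + 2 + 1) + i) hk
    rw [heq] at h
    have hg : (k.pieces (3 * j + 2 + 1)).T[i]'hlen = ⟨Kind.mux, [Sum.inl 0, Sum.inl (1 + i), Sum.inl (1 + W + i)]⟩ := by
      rw [List.getElem_of_eq hT]; exact getElem_muxRow W _
    rw [hg, hw, k.offset_M hj] at h
    have e : (o.inst (3 * W)).body ⟨Kind.mux, [Sum.inl 0, Sum.inl (1 + i), Sum.inl (1 + W + i)].map (remap (k.wM j) (k.offS j + 2 * k.T.length))⟩ =
        muxF (var (o.inp (W + j))) (var (k.p o j i)) (var (k.t o j i)) := by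
      show muxF (var ((o.inst (3 * W)).ref (remap (k.wM j) (k.offS j + 2 * k.T.length) (Sum.inl 0))))
          (var ((o.inst (3 * W)).ref (remap (k.wM j) (k.offS j + 2 * k.T.length) (Sum.inl (1 + i)))))
          (var ((o.inst (3 * W)).ref (remap (k.wM j) (k.offS j + 2 * k.T.length) (Sum.inl (1 + W + i))))) = _
      have w0 : k.wM j 0 = Sum.inl (W + j) := by simp [wM]
      have w1 : k.wM j (1 + i) = Sum.inr (k.offS j + k.T.length + k.resOff i) := by
        unfold wM; rw [if_neg (by omega), if_pos (by omega), show 1 + i - 1 = i by omega]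
      have w2 : k.wM j (1 + W + i) = k.tSrc j i := by unfold wM; rw [if_neg (by omega), if_neg (by omega), show 1 + W + i - (W + 1) = i by omega]
      simp only [remap, w0, w1, w2, ref_tSrc, o.ref_inl (show W + j < 3 * W by omega), Occ.ref_inr]
      simp only [p, res, Po, Occ.wire, Nat.add_assoc]
    rw [e] at h
    simpa [muxRel, t, Occ.wire_inst, Occ.wire, Nat.add_assoc] using h
  · -- comparator, piece `3W+1`
    have hT : (k.pieces (3 * W + 1)).T = Sub.subT W := by rw [k.pieces_cmp]
    have hw : (k.pieces (3 * W + 1)).wire = k.wC := by rw [k.pieces_cmp]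
    have h := Sub.avail_viewEmb (w := W) (off := offset k.pieces (3 * W + 1)) (wv := k.wC) hI fun q hq => by
      obtain ⟨hk', heq⟩ := getElem_layout k.pieces (k := 3 * W + 1) (N := 3 * W + 2) (j := q) (by omega) (by rw [hT]; exact hq)
      refine ⟨hk', ?_⟩
      rw [heq, List.getElem_of_eq hT, hw]
    rw [k.offset_C] at h
    refine h.congr rfl (fun i hi => ?_) fun i hi => ?_
    · show k.t o W i = (o.inst (3 * W)).ref (k.wC i); rw [wC, if_pos hi, ref_tSrc]
    · show o.inp (2 * W + i) = (o.inst (3 * W)).ref (k.wC (W + i)); rw [wC, if_neg (by omega), o.ref_inl (by omega)]; congr 1; ring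

end OpKit

end ModAdd

end Literature.Computability.MetaComplexity
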